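import Literature.NumberTheory.Automorphic.AdelicUnitaryGroupDatum      -- ★ `cmConjRingHom`, `embedding_cmConjRingHom`, `UnitaryGroup.anisotropic_of_posDef_map`
import Mathlib.NumberTheory.Cyclotomic.PrimitiveRoots                    -- `IsPrimitiveRoot.embeddingsEquivPrimitiveRoots`
import Mathlib.NumberTheory.NumberField.CMField                          -- `IsCyclotomicExtension.Rat.isCMField`
import Mathlib.RingTheory.RootsOfUnity.Complex                           -- `Complex.isPrimitiveRoot_exp_of_coprime`
import Literature.NumberTheory.Automorphic.PicardSexticDatum            -- ★ `PicardSextic.exp_mul_I_add_inv` (`e^{iθ} + e^{-iθ} = 2cos θ`)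
import HarnessLib

/-!
# K2 ∕ E5 «TamagawaUnitary» — the letter's non-similarity hypothesis `hns` is INHABITED (anti-vacuity witness)

Cell `hodgecm-mathlib`, Track B «K2-LIT», unit E5, refuter base K2E5-r01 (g4).  The E5 letter Z1♭♭ₐ♮
`F0P3cTprimeJPaydown.stub_rankTwoRecipeCovolEq_inner` (★ payer `K2E5RankTwoRecipeCovolEqInner.rankTwoRecipeCovolEqInner`)
quantifies in its second block over a hermitian anisotropic plane `Ha′ ∈ M₂(L)` NOT SIMILAR to the first plane `Ha`:
`hns : ¬ ∃ (c : L) (Q : GL (Fin 2) L), c ≠ 0 ∧ (Q̄ᵀ * Ha * Q) = c • Ha′`.  This file shows that the five ALGEBRAIC hypotheses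
of the two planes (`hHa`, `hpos`, `hHa′`, `hpos′`, `hns`) hold SIMULTANEOUSLY for a concrete pair, so the ★-paid letter is
not «true for lack of instances» in that block (the measure ∕ σ-algebra ∕ recipe-tower binders are inhabited for every
hermitian anisotropic `(L, Ha)` — ★ `TamagawaRecipeTowerUniqueExists.exists_recipeTower`, ★ `isHaarMeasure_count_quotientSubgroup`).

* §1 (any CM field `L`, any `b ∈ L`): `diag(1, b)` is anisotropic as soon as `τ b > 0` at ONE complex embedding `τ`
  (positive definite there); and **`1₂` is not similar to `diag(1, b)` as soon as `re (τ b) < 0` at ONE complex embedding**: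
  reading the two diagonal entries of `Q̄ᵀ Q = c • diag(1, b)` at `τ` gives `τ c = |τQ₀₀|² + |τQ₁₀|² > 0` (`c ≠ 0`) and
  `τ c · τ b = |τQ₀₁|² + |τQ₁₁|² ≥ 0`, whence `re (τ b) ≥ 0` — the sign of a hermitian form at an infinite place is a
  similarity invariant up to a totally positive factor.  No determinant, no norm group.
* §2 (any CM field that is `{5}`-cyclotomic over `ℚ`): `b = ζ₅ + ζ₅⁻¹` is real (`ū = u⁻¹` on roots of unity) and the
  embeddings `ζ₅ ↦ e^{2πij/5}` (`j = 1, 2`) give `τ₁ b = 2cos(2π/5) > 0`, `re (τ₂ b) = 2cos(4π/5) < 0`.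
* §3 `letter_hns_block_inhabited`: over `L = ℚ(ζ₅)` (CM by Mathlib `IsCyclotomicExtension.Rat.isCMField`) the pair
  `(1₂, diag(1, ζ₅ + ζ₅⁻¹))` satisfies `hHa ∧ hpos ∧ hHa′ ∧ hpos′ ∧ hns`, the last conjunct being the letter's `hns` BYTES.

Theorems only (no `def`, no `instance`, no notation, no `sorry`); lane `--supports stmt-HodgeConjecture-24833 --as helper`;
nothing here closes a socket.  HONEST LABEL: HC_CM is proved only modulo the 7 printed citations (2 remaining named inputs:
hLiu418 = stmt-HodgeConjecture-24832, h413 = stmt-HodgeConjecture-24833) until rung 0 closes; this file is count-neutral.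
-/

set_option autoImplicit false
-- the cell's namespace `Summit.HodgeConjecture.HodgeConjecture.…` (summit = problem) repeats a component by design
set_option linter.dupNamespace false

noncomputable section

namespace Summit.HodgeConjecture.HodgeConjecture.Cruxes.H413.K2E5LetterHnsWitness

open Matrix Complex NumberField Polynomial
open Literature.NumberTheory.Automorphic
open Literature.AlgebraicGeometry.ShimuraVarieties (hermForm map_hermForm hermForm_starRingEnd)
open scoped ComplexOrder Matrix Real

/-! ## §1 Generic over a CM field: the sign at one infinite place -/

section Generic

variable (L : Type) [Field L] [NumberField L] [IsCMField L]

/-- `1₂` is hermitian for the CM conjugation: `ᵗ(1̄) = 1`. [cite: Rogawski1990, §14.1 p. 232] -/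
theorem isHermitian_one₂ : ((1 : Matrix (Fin 2) (Fin 2) L).map (cmConjRingHom L)).transpose = 1 := by
  rw [Matrix.map_one (cmConjRingHom L) (map_zero _) (map_one _), Matrix.transpose_one]

/-- `1₂` is anisotropic over a CM field: `x̄₁x₁ + x̄₂x₂ = 0 ⇒ x = 0` (positive definite at any complex embedding,
★ `UnitaryGroup.anisotropic_of_posDef_map`). [cite: Rogawski1990, §14.1 p. 232] -/
theorem anisotropic_one₂ :
    ∀ x : Fin 2 → L, hermForm (cmConjRingHom L) (1 : Matrix (Fin 2) (Fin 2) L) x x = 0 → x = 0 := by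
  obtain ⟨τ⟩ := (inferInstance : Nonempty (L →+* ℂ))
  refine UnitaryGroup.anisotropic_of_posDef_map L (1 : Matrix (Fin 2) (Fin 2) L) τ ?_
  rw [Matrix.map_one τ (map_zero τ) (map_one τ)]
  exact Matrix.PosDef.one

variable {L}

/-- `diag(1, b)` is hermitian when `b̄ = b`. [cite: Rogawski1990, §14.1 p. 232] -/
theorem isHermitian_diag {b : L} (hb : cmConjRingHom L b = b) :
    ((!![1, 0; 0, b] : Matrix (Fin 2) (Fin 2) L).map (cmConjRingHom L)).transpose = !![1, 0; 0, b] := by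
  ext i j
  fin_cases i <;> fin_cases j <;> simp [Matrix.map_apply, hb]

/-- **Anisotropy from positivity at one place**: `diag(1, b)` is anisotropic as soon as `τ b > 0` (real and positive)
at ONE complex embedding `τ` (it is positive definite there). [cite: Rogawski1990, §14.1 p. 232] -/
theorem anisotropic_diag {b : L} (τ : L →+* ℂ) (hτ : 0 < τ b) :
    ∀ x : Fin 2 → L, hermForm (cmConjRingHom L) (!![1, 0; 0, b] : Matrix (Fin 2) (Fin 2) L) x x = 0 → x = 0 := by
  refine UnitaryGroup.anisotropic_of_posDef_map L _ τ ?_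
  have h : (!![1, 0; 0, b] : Matrix (Fin 2) (Fin 2) L).map τ = Matrix.diagonal ![1, τ b] := by
    ext i j
    fin_cases i <;> fin_cases j <;> simp [Matrix.map_apply]
  rw [h]
  refine Matrix.PosDef.diagonal ?_
  intro i
  fin_cases i
  · simp
  · simpa using hτ

/-- Under a complex embedding of a CM field, `τ (z̄ z) = |τ z|²`. [cite: Rogawski1990, §14.1 p. 232] -/
theorem embedding_cmConj_mul_self (τ : L →+* ℂ) (z : L) :
    τ (cmConjRingHom L z * z) = ((Complex.normSq (τ z) : ℝ) : ℂ) := by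
  rw [map_mul, embedding_cmConjRingHom, mul_comm, Complex.mul_conj]

/-- **Sign obstruction to similarity**: if `re (τ b) < 0` at ONE complex embedding `τ`, then `1₂` is not similar to
`diag(1, b)` — there are no `c ≠ 0`, `Q ∈ GL₂(L)` with `Q̄ᵀ · 1 · Q = c • diag(1, b)` (the letter's `hns` for this pair):
the two diagonal entries read at `τ` are `τ c = |τQ₀₀|² + |τQ₁₀|² > 0` and `τ c · τ b = |τQ₀₁|² + |τQ₁₁|² ≥ 0`.
[cite: Rogawski1990, §14.1 p. 232] -/
theorem not_similar_one_diag {b : L} (τ : L →+* ℂ) (hτ : (τ b).re < 0) :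
    ¬ ∃ (c : L) (Q : GL (Fin 2) L), c ≠ 0 ∧
      (((Q : GL (Fin 2) L) : Matrix (Fin 2) (Fin 2) L).map (cmConjRingHom L))ᵀ * (1 : Matrix (Fin 2) (Fin 2) L) *
        ((Q : GL (Fin 2) L) : Matrix (Fin 2) (Fin 2) L) = c • (!![1, 0; 0, b] : Matrix (Fin 2) (Fin 2) L) := by
  rintro ⟨c, Q, hc, h⟩
  set M : Matrix (Fin 2) (Fin 2) L := ((Q : GL (Fin 2) L) : Matrix (Fin 2) (Fin 2) L) with hM
  have e0 := congrFun (congrFun h 0) 0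
  have e1 := congrFun (congrFun h 1) 1
  simp only [Matrix.mul_apply, Matrix.transpose_apply, Matrix.map_apply, Matrix.smul_apply,
    smul_eq_mul, Fin.sum_univ_two, Matrix.of_apply, Matrix.cons_val', Matrix.cons_val_zero,
    Matrix.cons_val_one, Matrix.empty_val', Matrix.cons_val_fin_one, mul_one] at e0 e1
  -- read both identities at `τ`
  have t0 := congrArg τ e0
  have t1 := congrArg τ e1
  rw [map_add, embedding_cmConj_mul_self, embedding_cmConj_mul_self, ← Complex.ofReal_add] at t0
  rw [map_add, embedding_cmConj_mul_self, embedding_cmConj_mul_self, ← Complex.ofReal_add, map_mul] at t1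
  set S₀ : ℝ := Complex.normSq (τ (M 0 0)) + Complex.normSq (τ (M 1 0)) with hS₀
  set S₁ : ℝ := Complex.normSq (τ (M 0 1)) + Complex.normSq (τ (M 1 1)) with hS₁
  have hS₀nn : 0 ≤ S₀ := add_nonneg (Complex.normSq_nonneg _) (Complex.normSq_nonneg _)
  have hS₁nn : 0 ≤ S₁ := add_nonneg (Complex.normSq_nonneg _) (Complex.normSq_nonneg _)
  have hτc : τ c = (S₀ : ℂ) := t0.symm
  have hS₀pos : 0 < S₀ := by
    rcases hS₀nn.lt_or_eq with hlt | heq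
    · exact hlt
    · exfalso
      apply hc
      have : τ c = 0 := by rw [hτc, ← heq, Complex.ofReal_zero]
      exact (map_eq_zero τ).1 this
  have hre : S₀ * (τ b).re = S₁ := by
    have := congrArg Complex.re t1
    rw [hτc, Complex.re_ofReal_mul, Complex.ofReal_re] at this
    exact this.symm
  have hneg : S₀ * (τ b).re < 0 := mul_neg_of_pos_of_neg hS₀pos hτ
  linarith

/-- On elements of finite order complex conjugation is inversion: `ū = u⁻¹` if `uⁿ = 1` (`|τ u| = 1` at any complex
embedding). [cite: Rogawski1990, §14.1 p. 232] -/
theorem cmConj_eq_inv_of_pow_eq_one {u : L} {n : ℕ} (hn : n ≠ 0) (hu : u ^ n = 1) :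
    cmConjRingHom L u = u⁻¹ := by
  obtain ⟨τ⟩ := (inferInstance : Nonempty (L →+* ℂ))
  apply τ.injective
  have h1 : (τ u) ^ n = 1 := by rw [← map_pow, hu, map_one]
  have hnorm : ‖τ u‖ = 1 := Complex.norm_eq_one_of_pow_eq_one h1 hn
  rw [embedding_cmConjRingHom, map_inv₀, Complex.inv_eq_conj hnorm]

/-- Hence `u + u⁻¹` is real (`b̄ = b`) for any root of unity `u`. [cite: Rogawski1990, §14.1 p. 232] -/
theorem cmConj_add_inv_of_pow_eq_one {u : L} {n : ℕ} (hn : n ≠ 0) (hu : u ^ n = 1) :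
    cmConjRingHom L (u + u⁻¹) = u + u⁻¹ := by
  rw [map_add, map_inv₀, cmConj_eq_inv_of_pow_eq_one hn hu, inv_inv, add_comm]

end Generic

/-! ## §2 A `{5}`-cyclotomic CM field: `b = ζ₅ + ζ₅⁻¹` has one positive and one negative real conjugate -/

section Five

variable (L : Type) [Field L] [NumberField L] [IsCyclotomicExtension {5} ℚ L]

/-- `b = ζ₅ + ζ₅⁻¹` is real: `b̄ = b`. [cite: Rogawski1990, §14.1 p. 232] -/
theorem cmConj_zeta_add_inv [IsCMField L] :
    cmConjRingHom L (IsCyclotomicExtension.zeta 5 ℚ L + (IsCyclotomicExtension.zeta 5 ℚ L)⁻¹) =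
      IsCyclotomicExtension.zeta 5 ℚ L + (IsCyclotomicExtension.zeta 5 ℚ L)⁻¹ :=
  cmConj_add_inv_of_pow_eq_one (by norm_num) (IsCyclotomicExtension.zeta_spec 5 ℚ L).pow_eq_one

/-- For `j` prime to `5` there is a complex embedding `ζ₅ ↦ e^{2πij/5}` (Mathlib `embeddingsEquivPrimitiveRoots`).
[cite: Rogawski1990, §14.1 p. 232] -/
theorem exists_embedding_zeta (j : ℕ) (hj : j.Coprime 5) :
    ∃ τ : L →+* ℂ, τ (IsCyclotomicExtension.zeta 5 ℚ L) = Complex.exp (2 * π * I * (j / 5)) := by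
  have hζ := IsCyclotomicExtension.zeta_spec 5 ℚ L
  have hirr : Irreducible (cyclotomic 5 ℚ) := cyclotomic.irreducible_rat (by norm_num)
  have hμ : IsPrimitiveRoot (Complex.exp (2 * π * I * (j / 5))) 5 :=
    Complex.isPrimitiveRoot_exp_of_coprime j 5 (by norm_num) hj
  have hmem : Complex.exp (2 * π * I * (j / 5)) ∈ primitiveRoots 5 ℂ := (mem_primitiveRoots (by norm_num)).2 hμ
  refine ⟨((hζ.embeddingsEquivPrimitiveRoots ℂ hirr).symm ⟨_, hmem⟩ : L →ₐ[ℚ] ℂ).toRingHom, ?_⟩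
  have h := hζ.embeddingsEquivPrimitiveRoots_apply_coe ℂ hirr ((hζ.embeddingsEquivPrimitiveRoots ℂ hirr).symm ⟨_, hmem⟩)
  rw [Equiv.apply_symm_apply] at h
  rw [AlgHom.toRingHom_eq_coe, AlgHom.coe_toRingHom]
  exact h.symm

/-- An embedding `ζ₅ ↦ e^{2πij/5}` sends `b = ζ₅ + ζ₅⁻¹` to `2cos(2πj/5)`. [cite: Rogawski1990, §14.1 p. 232] -/
theorem embedding_zeta_add_inv {j : ℕ} {τ : L →+* ℂ}
    (hτ : τ (IsCyclotomicExtension.zeta 5 ℚ L) = Complex.exp (2 * π * I * (j / 5))) :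
    τ (IsCyclotomicExtension.zeta 5 ℚ L + (IsCyclotomicExtension.zeta 5 ℚ L)⁻¹) =
      ((2 * Real.cos (2 * π * j / 5) : ℝ) : ℂ) := by
  rw [map_add, map_inv₀, hτ, show (2 * ↑π * I * (↑j / 5) : ℂ) = ↑(2 * π * (j : ℝ) / 5) * I by push_cast; ring]
  exact PicardSextic.exp_mul_I_add_inv _

/-- `τ₁ : ζ₅ ↦ e^{2πi/5}` has `τ₁ b = 2cos(2π/5) > 0`. [cite: Rogawski1990, §14.1 p. 232] -/
theorem exists_embedding_zeta_add_inv_pos :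
    ∃ τ : L →+* ℂ, 0 < τ (IsCyclotomicExtension.zeta 5 ℚ L + (IsCyclotomicExtension.zeta 5 ℚ L)⁻¹) := by
  obtain ⟨τ, hτ⟩ := exists_embedding_zeta L 1 (by norm_num)
  refine ⟨τ, ?_⟩
  rw [embedding_zeta_add_inv L hτ, Complex.zero_lt_real]
  have hcos : 0 < Real.cos (2 * π * (1 : ℕ) / 5) := by
    apply Real.cos_pos_of_mem_Ioo
    constructor <;> · push_cast; nlinarith [Real.pi_pos]
  linarith

/-- `τ₂ : ζ₅ ↦ e^{4πi/5}` has `re (τ₂ b) = 2cos(4π/5) < 0`. [cite: Rogawski1990, §14.1 p. 232] -/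
theorem exists_embedding_zeta_add_inv_neg :
    ∃ τ : L →+* ℂ, (τ (IsCyclotomicExtension.zeta 5 ℚ L + (IsCyclotomicExtension.zeta 5 ℚ L)⁻¹)).re < 0 := by
  obtain ⟨τ, hτ⟩ := exists_embedding_zeta L 2 (by norm_num)
  refine ⟨τ, ?_⟩
  rw [embedding_zeta_add_inv L hτ, Complex.ofReal_re]
  have hcos : Real.cos (2 * π * (2 : ℕ) / 5) < 0 := by
    apply Real.cos_neg_of_pi_div_two_lt_of_lt <;> · push_cast; nlinarith [Real.pi_pos]
  linarith

end Five

/-! ## §3 The letter's `hns` block is inhabited -/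

/-- **The five algebraic hypotheses of the letter's two planes hold simultaneously for a concrete pair**: over the CM
field `ℚ(ζ₅)`, `Ha = 1₂` and `Ha′ = diag(1, ζ₅ + ζ₅⁻¹)` are hermitian and anisotropic, and NOT similar — the last
conjunct is the `hns` binder of `F0P3cTprimeJPaydown.stub_rankTwoRecipeCovolEq_inner` ∕ ★ `rankTwoRecipeCovolEqInner`
token for token (anti-vacuity of the letter's second block). [cite: Rogawski1990, §14.1 p. 232] -/
theorem letter_hns_block_inhabited :
    ∃ (L : Type) (_ : Field L) (_ : NumberField L) (_ : IsCMField L) (Ha Ha' : Matrix (Fin 2) (Fin 2) L),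
      (Ha.map (cmConjRingHom L)).transpose = Ha ∧
      (∀ x : Fin 2 → L, hermForm (cmConjRingHom L) Ha x x = 0 → x = 0) ∧
      (Ha'.map (cmConjRingHom L)).transpose = Ha' ∧
      (∀ x : Fin 2 → L, hermForm (cmConjRingHom L) Ha' x x = 0 → x = 0) ∧
      ¬ ∃ (c : L) (Q : GL (Fin 2) L), c ≠ 0 ∧
        (((Q : GL (Fin 2) L) : Matrix (Fin 2) (Fin 2) L).map (cmConjRingHom L))ᵀ * Ha *
          ((Q : GL (Fin 2) L) : Matrix (Fin 2) (Fin 2) L) = c • Ha' := by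
  haveI : IsCyclotomicExtension {5} ℚ (CyclotomicField 5 ℚ) := CyclotomicField.isCyclotomicExtension 5 ℚ
  haveI hCM : IsCMField (CyclotomicField 5 ℚ) :=
    IsCyclotomicExtension.Rat.isCMField (CyclotomicField 5 ℚ) (S := ({5} : Set ℕ)) ⟨5, rfl, by norm_num⟩
  obtain ⟨τ₁, h₁⟩ := exists_embedding_zeta_add_inv_pos (CyclotomicField 5 ℚ)
  obtain ⟨τ₂, h₂⟩ := exists_embedding_zeta_add_inv_neg (CyclotomicField 5 ℚ)
  exact ⟨CyclotomicField 5 ℚ, inferInstance, inferInstance, hCM, 1, !![1, 0; 0, _],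
    isHermitian_one₂ _, anisotropic_one₂ _, isHermitian_diag (cmConj_zeta_add_inv _), anisotropic_diag τ₁ h₁,
    not_similar_one_diag τ₂ h₂⟩

end Summit.HodgeConjecture.HodgeConjecture.Cruxes.H413.K2E5LetterHnsWitness

end
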